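import Summits.QuantumFields.YangMills.Theorems.BalabanUVNodesN13Cor3AEIffUpToVersionAtRecord13
import Literature.MathematicalPhysics.QuantumFieldTheory.Balaban1983to89.Node00.Record13SepCoPHV

/-!
# BalabanUVNodes ∕ N13 — THE ENGINE-FACING SLOT PRODUCER: N13's (UV) half AT A WORLD BOUND TO THE REVISED DATUM, with the world's OWN letters `γ, em, ep` and no Theorem-1 detour —
# from the engines' N13 row `hUV` («∀ U» at level 0, «`dV`-a.e. U» at levels ≥ 1; `SLaw₁₃CoPH` guards) and `0 ≤ em + ep` ⟹ `∃ v : Revision₁₃ θ h`, the GUARDED pointwise (2.50) for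
# `(datumOfRecord₁₃SepCoPHⱽ θ h v).C` with the SAME `γ, em, ep`; hence `(leavesP w P).smallCouplings → densitiesDescribed → uvBounds` at every world `w` bound to that revised datum

Cell `pub-ymgap` (HUMAN RULING D-0062 Track A ∕ D-0149 width), WIDTH SEAT `pub-ymgap-dag-n13-w2` (gen 4, CLAIM-6, INBOX l.36150), key K1⁹ `StabilityBRunRowsAtRecordR13SepCoPHV` = stmt-QuantumFields-27364 (route rev 29;
`--kind proof --supports … --as helper`; count-neutral).  OWN LINEAGE: the row-level producers p619268 → p621421 (dag-lead DEDUP-391 (b)); node00 DEF-1's slot p620607 BY NAME (`exists_revision₁₃_of_exists_update` at a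
guarded-(UV) `Q`, faces `flow_…V` ∕ `sect2Form_…V_iff`).  WHY: for the K1⁹ skeleton re-target (plan g85 sheet; dag-n13-w1 LOCATED-2 l.36098; this seat's p624941) the rung predicates key the witness world at the REVISED
datum, `w.C = (datumOfRecord₁₃SepCoPHⱽ F 2 θ h v).C`; N13's leaf `Dag.B16_main (leavesP w P)` then reads (DagBinding :1426–1429) `smallCouplings → densitiesDescribed → uvBounds` = the window `w.γ`, the guard
`∀ k ≤ K, (w.C P).Sect2Form k` (= `SLaw₁₃CoPH θ P k`, `Iff.rfl`) and (2.50) POINTWISE with the world's `w.em, w.ep` — for the RE-CHOSEN densities.  THIS FILE produces exactly that from the version-free rows, keeping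
`γ, em, ep` (no `min γ γ₁`, no `max ep (−em)`: under `0 ≤ em + ep` the barrier on the null exceptional sets is `exp(ep·|T₁^{(k)}|)` itself).  [III] = [Balaban1988Convergent], [B16] = [Balaban1989LargeFieldII].

WHAT THIS FILE PROVES (theorems only; 0 `def`; no `instance`, no `notation`; standard axioms; NO route-file import).
§1 [bookkeeping] GENERIC over `C : B16.Construction`, a guard `G P k : Prop` and exceptional sets: `uvIneq_barrier_le'` (`χ·exp(−g⁻²A − em·n) ≤ exp(ep·n)` under `χ ≤ 1`, `0 ≤ g⁻²A`, `0 ≤ em + ep`, `0 ≤ n`) ·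
   ★ `exists_rho_eqOn_uvGuarded_of_offSet` (guarded (2.50) OFF `E` ⟹ guarded (2.50) EVERYWHERE for `{C P with ρ := ρ′ P}`, SAME `γ em ep`, `ρ′ = ρ` off `E`).
§2 [bookkeeping] GENERIC core, level 0 kept: ★★ `exists_rho_keep0_ae_eq_uvGuarded_construction_of_row0_of_ae` (`M : RGMachineCore`, `ρ`; level 0 at every field, levels ≥ 1 `dV`-a.e., guard `G`).
§3 AT THE RECORD: ★★★ `exists_revision₁₃_uvGuarded_of_row0_of_aeRowSucc` — the engines' N13 row (γ, em, ep; `SLaw₁₃CoPH` guards; «∀ U»@0, «∀ᵐ U»@k+1) + `0 ≤ em + ep` ⟹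
   `∃ v : Revision₁₃ F N θ h, ∀ P, InInterval γ P.K → ∀ k ≤ P.K, SLaw₁₃CoPH θ P k → ∀ V, B16.UVIneq ((datumOfRecord₁₃SepCoPHV F N θ h v).C P) k V (em (g k)) (ep (g k))`;
   ★★ `uvBounds_leavesP_of_uvGuarded` — for every world `w` with `w.C = (datumOfRecord₁₃SepCoPHV … v).C`, `w.γ ≤ γ`, `w.em = em`, `w.ep = ep`: `∀ P, (leavesP w P).smallCouplings → (leavesP w P).densitiesDescribed →
   (leavesP w P).uvBounds` (the (UV)-half of N13's leaf at the revised world, letter for letter).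

HONEST FRAMING.  Count-neutral bookkeeping; the rows are HYPOTHESES (N13's (UV₁₃) content, version-free at levels ≥ 1 per director-ym №210 (5)); nothing of Bałaban's asserted or refuted; K1⁹ NEITHER proved NOR refuted; no
skeleton ∕ route text changed or proposed; N13 NOT discharged; counts unmoved (typed 28∕28 · discharged 5∕27 · A 5∕28); one finite `𝕋⁴_{L^K}` programme at fixed `ε = L^{−K}`, Bałaban AS PRINTED; route R4 closes the
CONDITIONAL finite-𝕋⁴ rung `BalabanLadder.UV` only — the Yang–Mills mass gap (Clay) is NOT proved by any of this; nothing continuum ∕ ℝ⁴ ∕ OS.  No `sorry`.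
-/

noncomputable section

open scoped ENNReal

namespace Summit.QuantumFields.YangMills.BalabanUVNodes.N13UVBoundsAtRevisedWorldOfEnginesRowAtRecord13

open MeasureTheory Set
open Literature.MathematicalPhysics.QuantumFieldTheory.Balaban1983to89
open Literature.MathematicalPhysics.QuantumFieldTheory.Balaban1983to89.T4Continuum (T4Family)
open Literature.MathematicalPhysics.QuantumFieldTheory.Balaban1983to89.Node00
open Literature.MathematicalPhysics.QuantumFieldTheory.Balaban1983to89.DagBinding (WorldP leavesP)
open Summit.QuantumFields.YangMills.BalabanUVNodes.N13Cor3AEIffUpToVersionAtRecord13 (signs_datum uvIneq_at_record₁₃SepCoPH_iff)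

/-! ## §1 GENERIC: guarded (2.50) off exceptional sets ⟹ guarded (2.50) everywhere for re-chosen densities, SAME letters -/

section Generic

open B16

variable (C : B16.Construction)

/-- `χ·exp(−g⁻²A − em·n) ≤ exp(ep·n)` when `χ ≤ 1`, `0 ≤ g⁻²·A`, `0 ≤ em + ep`, `0 ≤ n`. [cite: Balaban1988Convergent, Cor. 3 (2.50) p.264 (bookkeeping)] -/
theorem uvIneq_barrier_le' {χ a n em ep : ℝ} (hχ1 : χ ≤ 1) (ha : 0 ≤ a) (hc : 0 ≤ em + ep) (hn : 0 ≤ n) :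
    χ * Real.exp (-a - em * n) ≤ Real.exp (ep * n) := by
  have h1 : Real.exp (-a - em * n) ≤ Real.exp (ep * n) := by
    apply Real.exp_le_exp.mpr
    nlinarith
  calc χ * Real.exp (-a - em * n) ≤ 1 * Real.exp (-a - em * n) := mul_le_mul_of_nonneg_right hχ1 (Real.exp_pos _).le
    _ ≤ Real.exp (ep * n) := by rw [one_mul]; exact h1

open Classical in
/-- **★ GUARDED (2.50) OFF EXCEPTIONAL SETS ⟹ GUARDED (2.50) EVERYWHERE FOR RE-CHOSEN DENSITIES, SAME `γ, em, ep`.**  Guard `G P k`; if (2.50) with `em, ep` holds at every windowed run, level `k ≤ K` with `G P k`, and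
field off `E P k`, then `ρ′ :=` the barrier `exp(ep·|T₁^{(k)}|)` on `E P k`, `ρ` off it, satisfies the same guarded statement at EVERY field for `{C P with ρ := ρ′ P}` (given `χ ≤ 1`, `0 ≤ A^η`, `0 ≤ em + ep`).
[cite: Balaban1988Convergent, Cor. 3 (2.50) p.264; Balaban1989LargeFieldII, (0.1) pp.355–356 (bookkeeping)] -/
theorem exists_rho_eqOn_uvGuarded_of_offSet (G : B12.RunParams → ℕ → Prop) (E : (P : B12.RunParams) → (k : ℕ) → Set ((C P).Cfg k))
    (hχ : ∀ P k V, (C P).χ k V ≤ 1) (hA : ∀ P k V, 0 ≤ (C P).wilsonBG k V) {γ : ℝ} {em ep : ℝ → ℝ} (hc : ∀ g, 0 ≤ em g + ep g)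
    (hoff : ∀ P : B12.RunParams, (C P).flow.InInterval γ P.K → ∀ k, k ≤ P.K → G P k → ∀ V, V ∉ E P k →
      UVIneq (C P) k V (em ((C P).flow.g k)) (ep ((C P).flow.g k))) :
    ∃ ρ' : (P : B12.RunParams) → (k : ℕ) → (C P).Cfg k → ℝ,
      (∀ P k V, V ∉ E P k → ρ' P k V = (C P).ρ k V) ∧
        ∀ P : B12.RunParams, (C P).flow.InInterval γ P.K → ∀ k, k ≤ P.K → G P k → ∀ V,
          UVIneq ({ C P with ρ := ρ' P } : B16.RunData) k V (em ((C P).flow.g k)) (ep ((C P).flow.g k)) := by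
  refine ⟨fun P k V => if V ∈ E P k then Real.exp (ep ((C P).flow.g k) * ((C P).numSites k : ℝ)) else (C P).ρ k V, fun P k V hV => if_neg hV,
    fun P hP k hk hG V => ?_⟩
  by_cases hV : V ∈ E P k
  · refine ⟨?_, ?_⟩
    · show (C P).χ k V * Real.exp (-(1 / ((C P).flow.g k) ^ 2 * (C P).wilsonBG k V) - em ((C P).flow.g k) * ((C P).numSites k : ℝ)) ≤
        (if V ∈ E P k then Real.exp (ep ((C P).flow.g k) * ((C P).numSites k : ℝ)) else (C P).ρ k V)
      rw [if_pos hV]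
      exact uvIneq_barrier_le' (hχ P k V) (mul_nonneg (by positivity) (hA P k V)) (hc _) (Nat.cast_nonneg _)
    · show (if V ∈ E P k then Real.exp (ep ((C P).flow.g k) * ((C P).numSites k : ℝ)) else (C P).ρ k V) ≤ Real.exp (ep ((C P).flow.g k) * ((C P).numSites k : ℝ))
      rw [if_pos hV]
  · have h := hoff P hP k hk hG V hV
    refine ⟨?_, ?_⟩
    · show _ ≤ (if V ∈ E P k then _ else (C P).ρ k V)
      rw [if_neg hV]
      exact h.1
    · show (if V ∈ E P k then _ else (C P).ρ k V) ≤ _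
      rw [if_neg hV]
      exact h.2

end Generic

/-! ## §2 GENERIC CORE, LEVEL 0 KEPT: the guarded rows (∀@0, a.e.@≥1) ⟹ re-chosen densities with the guarded (2.50) everywhere -/

section Core

open T4DatumAssembly

variable {F : T4Family} {G : Type} [GaugeGroup G] [MeasurableSpace G] [HaarData G] (M : RGMachineCore F G)

open Classical in
/-- **★★ GENERIC CORE FORM, LEVEL 0 KEPT, GUARD `Gd`, SAME LETTERS**: for `M.construction ρ` with `χ ≤ 1`, `0 ≤ A^η`, `0 ≤ em + ep`: the guarded (2.50) at level 0 at EVERY field and at levels `k+1 ≤ K` for `dV`-a.e.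
field ⟹ `∃ ρ′, (∀ p, ρ′ p 0 = ρ p 0) ∧ (∀ p k, ρ′ p k =ᵐ[dV] ρ p k) ∧` the guarded (2.50) at EVERY field for `M.construction ρ′`, same `γ em ep`.
[cite: Balaban1988Convergent, Cor. 3 (2.50) p.264, (0.2) p.244 (bookkeeping)] -/
theorem exists_rho_keep0_ae_eq_uvGuarded_construction_of_row0_of_ae (ρ : (p : B12.RunParams) → (k : ℕ) → Density (F.P p.K) k G) (Gd : B12.RunParams → ℕ → Prop)
    (hχ : ∀ p k V, M.χ p k V ≤ 1) (hA : ∀ p k V, 0 ≤ M.wilsonBG p k V) {γ : ℝ} {em ep : ℝ → ℝ} (hc : ∀ g, 0 ≤ em g + ep g)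
    (h0 : ∀ p : B12.RunParams, (M.construction ρ p).flow.InInterval γ p.K → Gd p 0 → ∀ V,
      B16.UVIneq (M.construction ρ p) 0 V (em ((M.construction ρ p).flow.g 0)) (ep ((M.construction ρ p).flow.g 0)))
    (hae : ∀ p : B12.RunParams, (M.construction ρ p).flow.InInterval γ p.K → ∀ k, k + 1 ≤ p.K → Gd p (k + 1) →
      ∀ᵐ V ∂(fieldMeasure (F.P p.K) (k + 1) G), B16.UVIneq (M.construction ρ p) (k + 1) V (em ((M.construction ρ p).flow.g (k + 1))) (ep ((M.construction ρ p).flow.g (k + 1)))) :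
    ∃ ρ' : (p : B12.RunParams) → (k : ℕ) → Density (F.P p.K) k G,
      (∀ p, ρ' p 0 = ρ p 0) ∧ (∀ p k, ρ' p k =ᵐ[fieldMeasure (F.P p.K) k G] ρ p k) ∧
        ∀ p : B12.RunParams, (M.construction ρ' p).flow.InInterval γ p.K → ∀ k, k ≤ p.K → Gd p k → ∀ V,
          B16.UVIneq (M.construction ρ' p) k V (em ((M.construction ρ' p).flow.g k)) (ep ((M.construction ρ' p).flow.g k)) := by
  let E : (p : B12.RunParams) → (k : ℕ) → Set (GaugeField (F.P p.K) k G) := fun p k =>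
    {V | (M.construction ρ p).flow.InInterval γ p.K ∧ k ≤ p.K ∧ Gd p k ∧
      ¬ B16.UVIneq (M.construction ρ p) k V (em ((M.construction ρ p).flow.g k)) (ep ((M.construction ρ p).flow.g k))}
  have hE0 : ∀ p, E p 0 = ∅ := fun p => Set.eq_empty_iff_forall_notMem.mpr fun V hV => hV.2.2.2 (h0 p hV.1 hV.2.2.1 V)
  have hnull : ∀ p k, fieldMeasure (F.P p.K) k G (E p k) = 0 := by
    intro p k
    cases k with
    | zero => rw [hE0 p, measure_empty]
    | succ k =>
      by_cases hP : (M.construction ρ p).flow.InInterval γ p.K ∧ k + 1 ≤ p.K ∧ Gd p (k + 1)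
      · have hae' := hae p hP.1 k hP.2.1 hP.2.2
        rw [Filter.Eventually, mem_ae_iff] at hae'
        exact measure_mono_null (fun V hV => hV.2.2.2) hae'
      · have hE : E p (k + 1) = ∅ := Set.eq_empty_iff_forall_notMem.mpr fun V hV => hP ⟨hV.1, hV.2.1, hV.2.2.1⟩
        rw [hE, measure_empty]
  have hoff : ∀ p : B12.RunParams, (M.construction ρ p).flow.InInterval γ p.K → ∀ k, k ≤ p.K → Gd p k → ∀ V, V ∉ E p k →
      B16.UVIneq (M.construction ρ p) k V (em ((M.construction ρ p).flow.g k)) (ep ((M.construction ρ p).flow.g k)) := by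
    intro p hP k hk hG V hV
    by_contra hcon
    exact hV ⟨hP, hk, hG, hcon⟩
  obtain ⟨ρ', hoffE, hUV⟩ := exists_rho_eqOn_uvGuarded_of_offSet (M.construction ρ) Gd E hχ hA hc hoff
  refine ⟨ρ', fun p => funext fun V => hoffE p 0 V (by rw [hE0 p]; exact Set.notMem_empty V), fun p k => ?_, fun p hP k hk hG V => hUV p hP k hk hG V⟩
  filter_upwards [measure_eq_zero_iff_ae_notMem.1 (hnull p k)] with V hV
  exact hoffE p k V hV

end Core

/-! ## §3 AT THE RECORD: the slot's `∃ v` with the guarded pointwise (2.50) for the SAME letters; N13's (UV)-half at every world bound to the revised datum -/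

section Record

variable (F : T4Family) (N : ℕ) [NeZero N] (θ : Stage13HParams F N) (h : θ.Provisos₁₃SepCoPH F N)

/-- **★★★ THE ENGINE-FACING SLOT PRODUCER, SAME LETTERS**: the K1 engines' N13 row `hUV` — window `γ`, dependence functions `em, ep` with `0 ≤ em + ep`, guards `SLaw₁₃CoPH θ P k`, «every `U`» at level 0 and
«`dV`-a.e. `U`» at levels `k+1 ≤ K` — ⟹ `∃ v : Revision₁₃ F N θ h` such that at `(datumOfRecord₁₃SepCoPHV F N θ h v).C` the GUARDED (2.50) holds at EVERY field with the SAME `γ, em, ep`.  Via §2 at the record's core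
(signs by p619268's `signs_datum`, record letters by its `uvIneq_at_record₁₃SepCoPH_iff`) and DEF-1's `exists_revision₁₃_of_exists_update`.
[cite: Balaban1989LargeFieldII, (0.1) pp.355–356; Balaban1988Convergent, (2.18) p.257, Cor. 3 (2.50) p.264, (0.2) p.244 (bookkeeping)] -/
theorem exists_revision₁₃_uvGuarded_of_row0_of_aeRowSucc {γ : ℝ} {em ep : ℝ → ℝ} (hc : ∀ g, 0 ≤ em g + ep g)
    (hrow0 : ∀ P : B12.RunParams, ((datumOfRecord₁₃SepCoPH F N θ h).C P).flow.InInterval γ P.K → SLaw₁₃CoPH F N θ P 0 →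
      ∀ U : GaugeField (F.P P.K) 0 (SU N),
        chiβOfRecord₁₃ F N θ.toStage13Params P.K (gOfRecord₁₃ F N θ.toStage13Params P) 0 U *
              Real.exp (-(1 / (gOfRecord₁₃ F N θ.toStage13Params P 0) ^ 2 * wilsonBGOfRecord F N θ.εbg P 0 U)
                - em (gOfRecord₁₃ F N θ.toStage13Params P 0) * (Fintype.card (Site (F.P P.K) 0) : ℝ)) ≤ densOfRecord₁₃ F N θ.toStage13Params P 0 U ∧
          densOfRecord₁₃ F N θ.toStage13Params P 0 U ≤ Real.exp (ep (gOfRecord₁₃ F N θ.toStage13Params P 0) * (Fintype.card (Site (F.P P.K) 0) : ℝ)))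
    (hrow : ∀ P : B12.RunParams, ((datumOfRecord₁₃SepCoPH F N θ h).C P).flow.InInterval γ P.K → ∀ k, k + 1 ≤ P.K → SLaw₁₃CoPH F N θ P (k + 1) →
      ∀ᵐ U ∂(fieldMeasure (F.P P.K) (k + 1) (SU N)),
        chiβOfRecord₁₃ F N θ.toStage13Params P.K (gOfRecord₁₃ F N θ.toStage13Params P) (k + 1) U *
              Real.exp (-(1 / (gOfRecord₁₃ F N θ.toStage13Params P (k + 1)) ^ 2 * wilsonBGOfRecord F N θ.εbg P (k + 1) U)
                - em (gOfRecord₁₃ F N θ.toStage13Params P (k + 1)) * (Fintype.card (Site (F.P P.K) (k + 1)) : ℝ)) ≤ densOfRecord₁₃ F N θ.toStage13Params P (k + 1) U ∧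
          densOfRecord₁₃ F N θ.toStage13Params P (k + 1) U ≤ Real.exp (ep (gOfRecord₁₃ F N θ.toStage13Params P (k + 1)) * (Fintype.card (Site (F.P P.K) (k + 1)) : ℝ))) :
    ∃ v : Revision₁₃ F N θ h, ∀ P : B12.RunParams, ((datumOfRecord₁₃SepCoPHV F N θ h v).C P).flow.InInterval γ P.K → ∀ k, k ≤ P.K → SLaw₁₃CoPH F N θ P k →
      ∀ V : GaugeField (F.P P.K) k (SU N),
        B16.UVIneq ((datumOfRecord₁₃SepCoPHV F N θ h v).C P) k V (em (((datumOfRecord₁₃SepCoPHV F N θ h v).C P).flow.g k))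
          (ep (((datumOfRecord₁₃SepCoPHV F N θ h v).C P).flow.g k)) := by
  obtain ⟨ρ', h0, hae, hUV⟩ := exists_rho_keep0_ae_eq_uvGuarded_construction_of_row0_of_ae (coreOfRecord₁₃CoPH F N θ) (densOfRecord₁₃ F N θ.toStage13Params)
    (fun P k => SLaw₁₃CoPH F N θ P k) (fun P k V => (signs_datum F N θ h P k V).1) (fun P k V => (signs_datum F N θ h P k V).2) hc
    (fun P hP hS V => (uvIneq_at_record₁₃SepCoPH_iff F N θ h P 0 V _ _).mpr (hrow0 P hP hS V))
    (fun P hP k hk hS => by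
      filter_upwards [hrow P hP k hk hS] with U hU
      exact (uvIneq_at_record₁₃SepCoPH_iff F N θ h P (k + 1) U _ _).mpr hU)
  exact exists_revision₁₃_of_exists_update F N θ h
    (fun C => ∀ P : B12.RunParams, (C P).flow.InInterval γ P.K → ∀ k, k ≤ P.K → SLaw₁₃CoPH F N θ P k → ∀ V : (C P).Cfg k,
      B16.UVIneq (C P) k V (em ((C P).flow.g k)) (ep ((C P).flow.g k)))
    ⟨ρ', h0, fun P k _ => hae P (k + 1), hUV⟩

/-- **★★ N13's (UV)-HALF AT EVERY WORLD BOUND TO THE REVISED DATUM, LETTER FOR LETTER**: for `v` from `exists_revision₁₃_uvGuarded_of_row0_of_aeRowSucc` (or any `v` with the guarded (2.50) at `γ, em, ep`) and ANY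
`w : WorldP` with `w.C = (datumOfRecord₁₃SepCoPHV F N θ h v).C`, `w.γ ≤ γ`, `w.em = em`, `w.ep = ep`: `∀ P, (leavesP w P).smallCouplings → (leavesP w P).densitiesDescribed → (leavesP w P).uvBounds`
(DagBinding's fields: window `w.γ`; guard `∀ k ≤ K, (w.C P).Sect2Form k` — the revised construction's `Sect2Form` IS `SLaw₁₃CoPH θ P k` by DEF-1's `Iff.rfl` face and def-T's core; (2.50) pointwise with `w.em, w.ep`).
[cite: Balaban1989LargeFieldII, Thm 1 + (0.1) pp.355–356; Balaban1988Convergent, (2.18) p.257, Cor. 3 (2.50) p.264 (bookkeeping)] -/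
theorem uvBounds_leavesP_of_uvGuarded (v : Revision₁₃ F N θ h) {γ : ℝ} {em ep : ℝ → ℝ}
    (hUV : ∀ P : B12.RunParams, ((datumOfRecord₁₃SepCoPHV F N θ h v).C P).flow.InInterval γ P.K → ∀ k, k ≤ P.K → SLaw₁₃CoPH F N θ P k →
      ∀ V : GaugeField (F.P P.K) k (SU N),
        B16.UVIneq ((datumOfRecord₁₃SepCoPHV F N θ h v).C P) k V (em (((datumOfRecord₁₃SepCoPHV F N θ h v).C P).flow.g k))
          (ep (((datumOfRecord₁₃SepCoPHV F N θ h v).C P).flow.g k)))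
    (w : WorldP) (hC : w.C = (datumOfRecord₁₃SepCoPHV F N θ h v).C) (hγ : w.γ ≤ γ) (hem : w.em = em) (hep : w.ep = ep) :
    ∀ P : B12.RunParams, (leavesP w P).smallCouplings → (leavesP w P).densitiesDescribed → (leavesP w P).uvBounds := by
  cases w
  dsimp only at hC hγ hem hep
  subst hC hem hep
  intro P hsmall hdesc k hk V
  exact hUV P (fun j hj => ⟨(hsmall j hj).1, (hsmall j hj).2.trans hγ⟩) k hk
    ((sect2Form_datumOfRecord₁₃SepCoPHV_iff F N θ h v P k).mp (hdesc k hk)) V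

/-- **★★★ THE TWO TOGETHER**: the engines' N13 row (γ, em, ep; `0 ≤ em + ep`; «∀ U»@0, «∀ᵐ U»@≥1) ⟹ `∃ v`, for EVERY world bound to `datumOfRecord₁₃SepCoPHV … v` with `w.γ ≤ γ`, `w.em = em`, `w.ep = ep`:
`∀ P, (leavesP w P).smallCouplings → (leavesP w P).densitiesDescribed → (leavesP w P).uvBounds`. [cite: Balaban1989LargeFieldII, Thm 1 + (0.1) pp.355–356; Balaban1988Convergent, Cor. 3 (2.50) p.264 (bookkeeping)] -/
theorem exists_revision₁₃_uvBounds_leavesP_of_row0_of_aeRowSucc {γ : ℝ} {em ep : ℝ → ℝ} (hc : ∀ g, 0 ≤ em g + ep g)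
    (hrow0 : ∀ P : B12.RunParams, ((datumOfRecord₁₃SepCoPH F N θ h).C P).flow.InInterval γ P.K → SLaw₁₃CoPH F N θ P 0 →
      ∀ U : GaugeField (F.P P.K) 0 (SU N),
        chiβOfRecord₁₃ F N θ.toStage13Params P.K (gOfRecord₁₃ F N θ.toStage13Params P) 0 U *
              Real.exp (-(1 / (gOfRecord₁₃ F N θ.toStage13Params P 0) ^ 2 * wilsonBGOfRecord F N θ.εbg P 0 U)
                - em (gOfRecord₁₃ F N θ.toStage13Params P 0) * (Fintype.card (Site (F.P P.K) 0) : ℝ)) ≤ densOfRecord₁₃ F N θ.toStage13Params P 0 U ∧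
          densOfRecord₁₃ F N θ.toStage13Params P 0 U ≤ Real.exp (ep (gOfRecord₁₃ F N θ.toStage13Params P 0) * (Fintype.card (Site (F.P P.K) 0) : ℝ)))
    (hrow : ∀ P : B12.RunParams, ((datumOfRecord₁₃SepCoPH F N θ h).C P).flow.InInterval γ P.K → ∀ k, k + 1 ≤ P.K → SLaw₁₃CoPH F N θ P (k + 1) →
      ∀ᵐ U ∂(fieldMeasure (F.P P.K) (k + 1) (SU N)),
        chiβOfRecord₁₃ F N θ.toStage13Params P.K (gOfRecord₁₃ F N θ.toStage13Params P) (k + 1) U *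
              Real.exp (-(1 / (gOfRecord₁₃ F N θ.toStage13Params P (k + 1)) ^ 2 * wilsonBGOfRecord F N θ.εbg P (k + 1) U)
                - em (gOfRecord₁₃ F N θ.toStage13Params P (k + 1)) * (Fintype.card (Site (F.P P.K) (k + 1)) : ℝ)) ≤ densOfRecord₁₃ F N θ.toStage13Params P (k + 1) U ∧
          densOfRecord₁₃ F N θ.toStage13Params P (k + 1) U ≤ Real.exp (ep (gOfRecord₁₃ F N θ.toStage13Params P (k + 1)) * (Fintype.card (Site (F.P P.K) (k + 1)) : ℝ))) :
    ∃ v : Revision₁₃ F N θ h, ∀ w : WorldP, w.C = (datumOfRecord₁₃SepCoPHV F N θ h v).C → w.γ ≤ γ → w.em = em → w.ep = ep →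
      ∀ P : B12.RunParams, (leavesP w P).smallCouplings → (leavesP w P).densitiesDescribed → (leavesP w P).uvBounds := by
  obtain ⟨v, hUV⟩ := exists_revision₁₃_uvGuarded_of_row0_of_aeRowSucc F N θ h hc hrow0 hrow
  exact ⟨v, fun w hC hγ hem hep => uvBounds_leavesP_of_uvGuarded F N θ h v hUV w hC hγ hem hep⟩

end Record

end Summit.QuantumFields.YangMills.BalabanUVNodes.N13UVBoundsAtRevisedWorldOfEnginesRowAtRecord13

end
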